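import Mathlib
import HarnessLib

/-!
# The jump budget of a pencil of linear maps: `Σ_μ (dim ker(A + μB) − e₀)` is bounded by `dim(im A ∩ im B)`

Topic `Literature/LinearAlgebra/Matrix`; namespace `Literature.LinearAlgebra.Matrix` (companion of
`PencilRankDropCount.lean`, which COUNTS the parameters where a pencil drops rank; this file bounds the SUM of
the kernel jumps).

Let `K` be a field, `V, W` finite-dimensional `K`-spaces and `A, B : V → W` linear.  For `μ ∈ K` put
`U_μ = ker (A + μB)`, `V₀ = ker A ∩ ker B` (so `V₀ ≤ U_μ` for every `μ`) and `J = im A ∩ im B`.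

**The published source.** By Kronecker's theorem every pencil of rectangular matrices `A + λB` is strictly
equivalent to a quasi-diagonal canonical form built from blocks `L_ε` (`ε × (ε+1)`), `L_ηᵀ`, nilpotent blocks
`N^{(u)} = E + λH` ("infinite elementary divisors") and a regular block `J + λE`
[cite: Gantmacher1984, Vol. 2 Ch. XII §4 eq. (30), §5 Thm. 5 (Kronecker)].  Reading off the blocks (a column
minimal index `ε ≥ 1` contributes `1` to `dim U_μ − dim V₀` for every `μ` and `ε ≥ 1` to `dim J`; a column index
`ε = 0` is a vector of `V₀`; a finite elementary divisor `(λ − a)^s` with `a ≠ 0` contributes `1` to `dim U_a` only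
and `s ≥ 1` to `dim J`; the divisors `λ^s` (eigenvalue `0`), the infinite divisors `μ^s` and a row index `η`
contribute `s − 1, s − 1, η − 1 ≥ 0` to `dim J`
and nothing to any `U_μ`, `μ ≠ 0`) gives, for pairwise distinct NONZERO `μ_1, …, μ_r` and a further value `t₀`
with `e(t₀) = e_gen := dim_{K(λ)} ker(A + λB) − dim V₀` (the generic value),

  `Σ_{i=1}^{r} (e(μ_i) − e(t₀)) ≤ dim J − e(t₀)`,  where `e(μ) = dim U_μ − dim V₀`   (JUMP BUDGET).

**What this file proves** (sorry-free, any field, NO canonical form): the additive form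

  `Σ_{μ ∈ S} dim U_μ ≤ dim J + (#S − 1)·dim U_{t₀} + dim V₀`   (`sum_finrank_ker_add_smul_le`)

for every finite set `S ⊆ K ∖ {0}` and EVERY `t₀ ∈ K` (generic or not: a non-generic `t₀` only weakens the
bound; for `#S ≥ 1` it is equivalent to the displayed inequality, `sum_sub_finrank_ker_le_of_nonempty`, and for
`t₀ ≠ 0` it holds for every `S`, `sum_sub_finrank_ker_le`), by an elementary induction
on `dim V`: if some `U_c` (`c ∈ S`) contains `u ∉ V₀`, pass to the pencil `Ā, B̄ : V/Ku → W/K·Bu` (well defined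
since `Au = −c·Bu`); then `dim Ū_μ ≥ dim U_μ` for `μ ∈ S ∖ {c}` (because `(A + μB)u = (μ − c)Bu ≠ 0`),
`dim Ū_{t₀} ≤ dim U_{t₀}`, `dim J̄ = dim J − 1` (because `Bu ∈ J`, using `c ≠ 0`), and either `Bu ∈ im(A + cB)`,
in which case `dim Ū_c ≥ dim U_c` and `dim V̄₀ ≤ dim V₀ + 1`, or `Bu ∉ im(A + cB)`, in which case
`dim Ū_c ≥ dim U_c − 1` and `dim V̄₀ ≤ dim V₀`; in both cases the inequality for `(Ā, B̄)` implies the one for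
`(A, B)`.

Corollaries: the one-value JUMP BOUND `dim U_μ ≤ dim J + dim V₀` for `μ ≠ 0` (`finrank_ker_add_smul_le_of_ne_zero`);
the COUNT of exceptional values `#{μ ≠ 0 : dim U_μ > dim U_{t₀}} ≤ dim J + dim V₀ − dim U_{t₀}` for `t₀ ≠ 0`
(`card_add_finrank_ker_le`, `setOf_finrank_ker_lt_finite`, `ncard_setOf_finrank_ker_lt_add_le`; compare the rank
count `#{t ≠ 0 : rank(A+tB) < s} + s ≤ rank A + rank B` of `PencilRankDropCount.lean` after
[cite: Kloosterman2025, Lemma 2.6] — the present bound is sharper by `(dim(im A + im B) − rank(A + t₀B)) +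
(dim U_{t₀} − dim V₀)`); and EXHAUSTION: if finitely many nonzero values `T` already exhaust the budget,
`Σ_{τ ∈ T} (dim U_τ − dim U_{t₀}) = dim J + dim V₀ − dim U_{t₀}`, then `dim U_μ ≤ dim U_{t₀}` for every other
nonzero `μ` (`finrank_ker_add_smul_le_of_exhausted`) — so a sampled list of special values is then complete.

Use (Hodge-locus census, cell `pub-hlocus`, records QUARTIC-PAIRS §3c / TWISTED-PAIRS: `A, B` = multiplication by
two cycle classes on a graded piece of an Artinian Gorenstein ring, `e(μ)` = first-order excess of the class
`[P] + μ[P′]`, `J_t = im α ∩ im β`): this is the 'jump-budget lemma' that turns sampled special values into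
complete lists.  NOT here: the Kronecker canonical form itself, the equality (exhaustion) criterion in terms of
minimal indices, the value `e_gen` as a rank over `K(λ)`.
-/

namespace Literature.LinearAlgebra.Matrix

open Module

universe u v

section Helpers

variable {K : Type*} [Field K] {V W : Type*} [AddCommGroup V] [Module K V] [AddCommGroup W] [Module K W]

/-- For subspaces `X, P ≤ V`: `dim (image of X in V ⧸ P) + dim (X ∩ P) = dim X` (rank–nullity for
`X → V ⧸ P`). [folklore] -/
private theorem finrank_map_mkQ_add [FiniteDimensional K V] (X P : Submodule K V) :
    finrank K ↥(X.map P.mkQ) + finrank K ↥(X ⊓ P) = finrank K ↥X := by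
  have h := LinearMap.finrank_range_add_finrank_ker (P.mkQ.domRestrict X)
  rw [LinearMap.range_domRestrict, LinearMap.ker_domRestrict, Submodule.ker_mkQ,
    ← Submodule.finrank_map_subtype_eq X (Submodule.comap X.subtype P),
    Submodule.map_comap_subtype] at h
  exact h

/-- If `u ∈ X` is nonzero, the image of `X` in `V ⧸ Ku` has dimension `dim X − 1`. [folklore] -/
private theorem finrank_map_mkQ_add_one [FiniteDimensional K V] (X : Submodule K V) {u : V}
    (hu : u ∈ X) (hu0 : u ≠ 0) : finrank K ↥(X.map (K ∙ u).mkQ) + 1 = finrank K ↥X := by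
  have h := finrank_map_mkQ_add X (K ∙ u)
  rwa [inf_eq_right.mpr ((Submodule.span_singleton_le_iff_mem u X).mpr hu),
    finrank_span_singleton hu0] at h

/-- If `u ∉ X`, the image of `X` in `V ⧸ Ku` has dimension `dim X`. [folklore] -/
private theorem finrank_map_mkQ_of_not_mem [FiniteDimensional K V] (X : Submodule K V) {u : V}
    (hu : u ∉ X) : finrank K ↥(X.map (K ∙ u).mkQ) = finrank K ↥X := by
  have hu0 : u ≠ 0 := fun h => hu (h ▸ X.zero_mem)
  have h := finrank_map_mkQ_add X (K ∙ u)
  rwa [((Submodule.disjoint_span_singleton' hu0).mpr hu).eq_bot, finrank_bot, add_zero] at h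

/-- Images in a quotient `V ⧸ P` with `P ≤ X`: `X̄ ∩ Ȳ ≤ (X ∩ Y)‾` (the reverse inclusion always holds).
[folklore] -/
private theorem map_mkQ_inf_le (X Y P : Submodule K V) (hP : P ≤ X) :
    X.map P.mkQ ⊓ Y.map P.mkQ ≤ (X ⊓ Y).map P.mkQ := by
  rintro z ⟨⟨x, hx, rfl⟩, ⟨y, hy, hxy⟩⟩
  have hyx : y - x ∈ P := by
    rw [Submodule.mkQ_apply, Submodule.mkQ_apply, Submodule.Quotient.eq] at hxy
    exact hxy
  refine ⟨y, ⟨?_, hy⟩, hxy⟩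
  have : y = x + (y - x) := by abel
  rw [this]
  exact X.add_mem hx (hP hyx)

/-- `dim (X ∩ f⁻¹ p) ≤ dim (X ∩ ker f) + dim p` (rank–nullity for `f` restricted to `X ∩ f⁻¹ p`). [folklore] -/
private theorem finrank_inf_comap_le [FiniteDimensional K V] [FiniteDimensional K W] (f : V →ₗ[K] W)
    (X : Submodule K V) (p : Submodule K W) :
    finrank K ↥(X ⊓ p.comap f) ≤ finrank K ↥(X ⊓ LinearMap.ker f) + finrank K ↥p := by
  set Y := X ⊓ p.comap f with hY
  have h := LinearMap.finrank_range_add_finrank_ker (f.domRestrict Y)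
  rw [LinearMap.range_domRestrict, LinearMap.ker_domRestrict,
    ← Submodule.finrank_map_subtype_eq Y (Submodule.comap Y.subtype (LinearMap.ker f)),
    Submodule.map_comap_subtype] at h
  have h1 : finrank K ↥(Y.map f) ≤ finrank K ↥p :=
    Submodule.finrank_mono ((Submodule.map_mono inf_le_right).trans (Submodule.map_comap_le f p))
  have h2 : finrank K ↥(Y ⊓ LinearMap.ker f) ≤ finrank K ↥(X ⊓ LinearMap.ker f) :=
    Submodule.finrank_mono (inf_le_inf_right _ inf_le_left)
  omega

/-- `dim f⁻¹ p ≤ dim ker f + dim p`. [folklore] -/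
private theorem finrank_comap_le [FiniteDimensional K V] [FiniteDimensional K W] (f : V →ₗ[K] W)
    (p : Submodule K W) :
    finrank K ↥(p.comap f) ≤ finrank K ↥(LinearMap.ker f) + finrank K ↥p := by
  have h := finrank_inf_comap_le f ⊤ p
  rwa [top_inf_eq, top_inf_eq] at h

/-- The common kernel `ker A ∩ ker B` lies in every `ker (A + μB)`. [folklore] -/
private theorem inf_ker_le_ker_add_smul (A B : V →ₗ[K] W) (μ : K) :
    LinearMap.ker A ⊓ LinearMap.ker B ≤ LinearMap.ker (A + μ • B) := by
  rintro x ⟨hA, hB⟩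
  rw [SetLike.mem_coe, LinearMap.mem_ker] at hA hB
  rw [LinearMap.mem_ker, LinearMap.add_apply, LinearMap.smul_apply, hA, hB, smul_zero, add_zero]

/-- Membership in `ker (A + μB)` spelled out. [folklore] -/
private theorem mem_ker_add_smul {A B : V →ₗ[K] W} {μ : K} {x : V} :
    x ∈ LinearMap.ker (A + μ • B) ↔ A x + μ • B x = 0 := by
  rw [LinearMap.mem_ker, LinearMap.add_apply, LinearMap.smul_apply]

end Helpers

section QuotientPencil

variable {K : Type*} [Field K] {V W : Type*} [AddCommGroup V] [Module K V] [AddCommGroup W] [Module K W]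

/-- The quotient pencil: for subspaces `P ≤ V`, `L ≤ W` with `A P, B P ⊆ L`, the kernel of
`Ā + μB̄ : V ⧸ P → W ⧸ L` is the image of `(A + μB)⁻¹ L`. [folklore] -/
private theorem ker_mapQ_add_smul (A B : V →ₗ[K] W) (P : Submodule K V) (L : Submodule K W)
    (hA : P ≤ L.comap A) (hB : P ≤ L.comap B) (μ : K) :
    LinearMap.ker (P.mapQ L A hA + μ • P.mapQ L B hB) = (L.comap (A + μ • B)).map P.mkQ := by
  have hAB : P ≤ L.comap (A + μ • B) := by
    intro x hx
    rw [Submodule.mem_comap, LinearMap.add_apply, LinearMap.smul_apply]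
    exact L.add_mem (hA hx) (L.smul_mem μ (hB hx))
  have h : P.mapQ L A hA + μ • P.mapQ L B hB = P.mapQ L (A + μ • B) hAB := by
    apply Submodule.linearMap_qext
    rw [LinearMap.add_comp, LinearMap.smul_comp, Submodule.mapQ_mkQ, Submodule.mapQ_mkQ,
      Submodule.mapQ_mkQ, LinearMap.comp_add, LinearMap.comp_smul]
  rw [h, Submodule.ker_mapQ]

end QuotientPencil

section Main

variable {K : Type*} [Field K]

/-- Induction core of `sum_finrank_ker_add_smul_le` (strong induction on `dim V`, uniformly in `V, W`).
[cite: Gantmacher1984, Vol. 2 Ch. XII §4 eq. (30), §5 Thm. 5 (Kronecker); consequence] -/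
private theorem sum_finrank_ker_add_smul_le_aux (S : Finset K) (hS : ∀ μ ∈ S, μ ≠ 0) (t₀ : K)
    (n : ℕ) :
    ∀ {V : Type u} {W : Type v} [AddCommGroup V] [Module K V] [FiniteDimensional K V]
      [AddCommGroup W] [Module K W] [FiniteDimensional K W] (A B : V →ₗ[K] W), finrank K V = n →
      ∑ μ ∈ S, finrank K ↥(LinearMap.ker (A + μ • B)) ≤
        finrank K ↥(LinearMap.range A ⊓ LinearMap.range B)
          + (S.card - 1) * finrank K ↥(LinearMap.ker (A + t₀ • B))
          + finrank K ↥(LinearMap.ker A ⊓ LinearMap.ker B) := by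
  induction' n using Nat.strong_induction_on with n ih
  intro V W _ _ _ _ _ _ A B hn
  classical
  -- notation
  set V₀ := LinearMap.ker A ⊓ LinearMap.ker B with hV₀
  set J := LinearMap.range A ⊓ LinearMap.range B with hJ
  have hV₀U : ∀ μ : K, V₀ ≤ LinearMap.ker (A + μ • B) := inf_ker_le_ker_add_smul A B
  by_cases hex : ∃ c ∈ S, finrank K ↥V₀ < finrank K ↥(LinearMap.ker (A + c • B))
  swap
  · -- trivial case: every `U_μ`, `μ ∈ S`, equals `V₀`
    have htriv : ∀ μ ∈ S, finrank K ↥(LinearMap.ker (A + μ • B)) ≤ finrank K ↥V₀ :=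
      fun μ hμ => not_lt.mp fun h => hex ⟨μ, hμ, h⟩
    have h0 : finrank K ↥V₀ ≤ finrank K ↥(LinearMap.ker (A + t₀ • B)) :=
      Submodule.finrank_mono (hV₀U t₀)
    calc ∑ μ ∈ S, finrank K ↥(LinearMap.ker (A + μ • B))
        ≤ ∑ μ ∈ S, finrank K ↥V₀ := Finset.sum_le_sum htriv
      _ = S.card * finrank K ↥V₀ := by rw [Finset.sum_const, smul_eq_mul]
      _ ≤ finrank K ↥J + (S.card - 1) * finrank K ↥(LinearMap.ker (A + t₀ • B)) + finrank K ↥V₀ := by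
          rcases Nat.eq_zero_or_pos S.card with hc | hc
          · rw [hc]; simp
          · obtain ⟨k, hk⟩ : ∃ k, S.card = k + 1 := ⟨S.card - 1, by omega⟩
            rw [hk, Nat.add_sub_cancel, add_mul, one_mul]
            have := Nat.mul_le_mul_left k h0
            omega
  · -- inductive case: pick `c ∈ S` and `u ∈ ker (A + cB)` outside `V₀`
    obtain ⟨c, hcS, hlt⟩ := hex
    have hc0 : c ≠ 0 := hS c hcS
    obtain ⟨u, huc, huV₀⟩ :=
      SetLike.exists_of_lt (Submodule.lt_of_le_of_finrank_lt_finrank (hV₀U c) hlt)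
    have hAu : A u = -c • B u := by
      rw [mem_ker_add_smul] at huc
      rw [neg_smul]; exact eq_neg_of_add_eq_zero_left huc
    have hw0 : B u ≠ 0 := by
      intro h
      apply huV₀
      refine ⟨?_, ?_⟩
      · rw [SetLike.mem_coe, LinearMap.mem_ker, hAu, h, smul_zero]
      · rw [SetLike.mem_coe, LinearMap.mem_ker, h]
    have hu0 : u ≠ 0 := fun h => hw0 (by rw [h, map_zero])
    have hTu : ∀ μ : K, (A + μ • B) u = (μ - c) • B u := by
      intro μ
      rw [LinearMap.add_apply, LinearMap.smul_apply, hAu, sub_smul, neg_smul]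
      abel
    -- the quotient pencil `Ā, B̄ : V ⧸ Ku → W ⧸ K(Bu)`
    set L : Submodule K W := K ∙ B u with hL
    set P : Submodule K V := K ∙ u with hP
    have hwL : B u ∈ L := Submodule.mem_span_singleton_self _
    have huP : u ∈ P := Submodule.mem_span_singleton_self _
    have hPA : P ≤ L.comap A := by
      rw [hP, Submodule.span_singleton_le_iff_mem, Submodule.mem_comap, hAu]
      exact L.smul_mem _ hwL
    have hPB : P ≤ L.comap B := by
      rw [hP, Submodule.span_singleton_le_iff_mem, Submodule.mem_comap]
      exact hwL
    set A' := P.mapQ L A hPA with hA'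
    set B' := P.mapQ L B hPB with hB'
    have hker : ∀ μ : K,
        LinearMap.ker (A' + μ • B') = (L.comap (A + μ • B)).map P.mkQ :=
      ker_mapQ_add_smul A B P L hPA hPB
    -- dimension of the quotient and the induction hypothesis
    have hdimV : finrank K (V ⧸ P) + 1 = n := by
      rw [← hn, ← Submodule.finrank_quotient_add_finrank P, hP, finrank_span_singleton hu0]
    have IH := ih (finrank K (V ⧸ P)) (by omega) A' B' rfl
    -- (F1) for `μ ≠ c`: `dim U_μ ≤ dim Ū_μ`
    have hUP : ∀ μ : K, (LinearMap.ker (A + μ • B)).map P.mkQ ≤ LinearMap.ker (A' + μ • B') := by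
      intro μ
      rw [hker]
      refine Submodule.map_mono ?_
      rw [← Submodule.comap_bot]
      exact Submodule.comap_mono bot_le
    have F1 : ∀ μ : K, μ ≠ c →
        finrank K ↥(LinearMap.ker (A + μ • B)) ≤ finrank K ↥(LinearMap.ker (A' + μ • B')) := by
      intro μ hμc
      have hu : u ∉ LinearMap.ker (A + μ • B) := by
        rw [LinearMap.mem_ker, hTu]
        exact smul_ne_zero (sub_ne_zero.mpr hμc) hw0
      rw [← finrank_map_mkQ_of_not_mem (LinearMap.ker (A + μ • B)) hu]
      exact Submodule.finrank_mono (hUP μ)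
    -- (F2) `dim Ū_{t₀} ≤ dim U_{t₀}`
    have F2 : finrank K ↥(LinearMap.ker (A' + t₀ • B')) ≤ finrank K ↥(LinearMap.ker (A + t₀ • B)) := by
      rw [hker]
      have hu : u ∈ L.comap (A + t₀ • B) := by
        rw [Submodule.mem_comap, hTu]
        exact L.smul_mem _ hwL
      have h1 := finrank_map_mkQ_add_one (L.comap (A + t₀ • B)) hu hu0
      have h2 := finrank_comap_le (A + t₀ • B) L
      have h3 : finrank K ↥L = 1 := finrank_span_singleton hw0
      rw [← hP] at h1
      omega
    -- (F3) `dim J̄ + 1 ≤ dim J`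
    have hwJ : B u ∈ J := by
      refine ⟨⟨(-c)⁻¹ • u, ?_⟩, ⟨u, rfl⟩⟩
      rw [map_smul, hAu, smul_smul, inv_mul_cancel₀ (neg_ne_zero.mpr hc0), one_smul]
    have F3 : finrank K ↥(LinearMap.range A' ⊓ LinearMap.range B') + 1 ≤ finrank K ↥J := by
      have hJ' : LinearMap.range A' ⊓ LinearMap.range B' ≤ J.map L.mkQ := by
        rw [hA', hB', Submodule.range_mapQ, Submodule.range_mapQ]
        refine map_mkQ_inf_le _ _ L ?_
        rw [hL, Submodule.span_singleton_le_iff_mem]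
        exact hwJ.1
      have h1 := finrank_map_mkQ_add_one J hwJ hw0
      have h2 := Submodule.finrank_mono hJ'
      rw [← hL] at h1
      omega
    -- `V̄₀ ≤ image of Ṽ₀ = A⁻¹L ∩ B⁻¹L`, and `u ∈ Ṽ₀`
    have hV₀' : LinearMap.ker A' ⊓ LinearMap.ker B' ≤ (L.comap A ⊓ L.comap B).map P.mkQ := by
      rw [hA', hB', Submodule.ker_mapQ, Submodule.ker_mapQ]
      exact map_mkQ_inf_le _ _ P hPA
    have huVt : u ∈ L.comap A ⊓ L.comap B := ⟨hPA huP, hPB huP⟩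
    -- split the sum at `c`
    have hsplit : ∀ f : K → ℕ, ∑ μ ∈ S, f μ = f c + ∑ μ ∈ S.erase c, f μ :=
      fun f => (Finset.add_sum_erase S f hcS).symm
    have hrest : ∑ μ ∈ S.erase c, finrank K ↥(LinearMap.ker (A + μ • B)) ≤
        ∑ μ ∈ S.erase c, finrank K ↥(LinearMap.ker (A' + μ • B')) :=
      Finset.sum_le_sum fun μ hμ => F1 μ (Finset.ne_of_mem_erase hμ)
    have hmul : (S.card - 1) * finrank K ↥(LinearMap.ker (A' + t₀ • B')) ≤
        (S.card - 1) * finrank K ↥(LinearMap.ker (A + t₀ • B)) := Nat.mul_le_mul_left _ F2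
    rw [hsplit] at IH ⊢
    -- (F4) case split on `Bu ∈ im (A + cB)`
    by_cases hcase : B u ∈ LinearMap.range (A + c • B)
    · -- case (a): `dim Ū_c ≥ dim U_c` and `dim V̄₀ ≤ dim V₀ + 1`
      have F4 : finrank K ↥(LinearMap.ker (A + c • B)) ≤ finrank K ↥(LinearMap.ker (A' + c • B')) := by
        obtain ⟨v, hv⟩ := hcase
        have hlt' : LinearMap.ker (A + c • B) < L.comap (A + c • B) := by
          refine lt_of_le_of_ne ?_ ?_
          · rw [← Submodule.comap_bot]; exact Submodule.comap_mono bot_le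
          · intro h
            have hv' : v ∈ L.comap (A + c • B) := by rw [Submodule.mem_comap, hv]; exact hwL
            rw [← h, LinearMap.mem_ker, hv] at hv'
            exact hw0 hv'
        have h1 := Submodule.finrank_lt_finrank_of_lt hlt'
        have hu : u ∈ L.comap (A + c • B) := by
          rw [Submodule.mem_comap, hTu, sub_self, zero_smul]; exact L.zero_mem
        have h2 := finrank_map_mkQ_add_one (L.comap (A + c • B)) hu hu0
        rw [← hP] at h2
        rw [hker]
        omega
      have F5 : finrank K ↥(LinearMap.ker A' ⊓ LinearMap.ker B') ≤ finrank K ↥V₀ + 1 := by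
        have h1 := Submodule.finrank_mono hV₀'
        have h2 := finrank_map_mkQ_add_one (L.comap A ⊓ L.comap B) huVt hu0
        rw [← hP] at h2
        have h3 := finrank_inf_comap_le B (L.comap A) L
        have h4 := finrank_inf_comap_le A (LinearMap.ker B) L
        have h5 : finrank K ↥L = 1 := finrank_span_singleton hw0
        rw [inf_comm (L.comap A) (LinearMap.ker B)] at h3
        rw [inf_comm (LinearMap.ker B) (LinearMap.ker A), ← hV₀] at h4
        omega
      omega
    · -- case (b): `dim Ū_c + 1 ≥ dim U_c` and `dim V̄₀ ≤ dim V₀`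
      have F4 : finrank K ↥(LinearMap.ker (A + c • B)) ≤ finrank K ↥(LinearMap.ker (A' + c • B')) + 1 := by
        have h1 := finrank_map_mkQ_add_one (LinearMap.ker (A + c • B)) huc hu0
        rw [← hP] at h1
        have h2 := Submodule.finrank_mono (hUP c)
        omega
      have F5 : finrank K ↥(LinearMap.ker A' ⊓ LinearMap.ker B') ≤ finrank K ↥V₀ := by
        -- `Ṽ₀ ≤ V₀ + Ku`
        have hVt : L.comap A ⊓ L.comap B ≤ V₀ ⊔ P := by
          rintro v ⟨hvA, hvB⟩
          rw [SetLike.mem_coe, Submodule.mem_comap, hL, Submodule.mem_span_singleton] at hvA hvB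
          obtain ⟨a, ha⟩ := hvA
          obtain ⟨b, hb⟩ := hvB
          have hB' : B (v - b • u) = 0 := by rw [map_sub, map_smul, ← hb, sub_self]
          have hA' : A (v - b • u) = (a + b * c) • B u := by
            rw [map_sub, map_smul, ← ha, hAu, add_smul, smul_smul, mul_neg, neg_smul, sub_neg_eq_add]
          have habc : a + b * c = 0 := by
            by_contra hne
            apply hcase
            refine ⟨(a + b * c)⁻¹ • (v - b • u), ?_⟩
            rw [map_smul, LinearMap.add_apply, LinearMap.smul_apply, hA', hB', smul_zero, add_zero,
              smul_smul, inv_mul_cancel₀ hne, one_smul]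
          rw [habc, zero_smul] at hA'
          rw [Submodule.mem_sup]
          refine ⟨v - b • u, ⟨?_, ?_⟩, b • u, P.smul_mem b huP, sub_add_cancel v _⟩
          · rw [SetLike.mem_coe, LinearMap.mem_ker]; exact hA'
          · rw [SetLike.mem_coe, LinearMap.mem_ker]; exact hB'
        have h1 : LinearMap.ker A' ⊓ LinearMap.ker B' ≤ V₀.map P.mkQ := by
          refine hV₀'.trans ((Submodule.map_mono hVt).trans ?_)
          rw [Submodule.map_sup, Submodule.mkQ_map_self, sup_bot_eq]
        exact (Submodule.finrank_mono h1).trans (Submodule.finrank_map_le _ _)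
      omega

/-- **Jump budget of a pencil** (additive form).  `K` a field, `A, B : V → W` linear maps of
finite-dimensional spaces, `S` a finite set of NONZERO scalars, `t₀ ∈ K` arbitrary:
`Σ_{μ ∈ S} dim ker(A + μB) ≤ dim(im A ∩ im B) + (#S − 1)·dim ker(A + t₀B) + dim(ker A ∩ ker B)`.
Consequence of the Kronecker canonical form of the pencil `A + λB`
[cite: Gantmacher1984, Vol. 2 Ch. XII §4 eq. (30), §5 Thm. 5 (Kronecker)]; proved here by induction on
`dim V` without the canonical form (see the module docstring). -/
theorem sum_finrank_ker_add_smul_le {V W : Type*} [AddCommGroup V] [Module K V] [FiniteDimensional K V]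
    [AddCommGroup W] [Module K W] [FiniteDimensional K W] (A B : V →ₗ[K] W) (S : Finset K)
    (hS : ∀ μ ∈ S, μ ≠ 0) (t₀ : K) :
    ∑ μ ∈ S, finrank K ↥(LinearMap.ker (A + μ • B)) ≤
      finrank K ↥(LinearMap.range A ⊓ LinearMap.range B)
        + (S.card - 1) * finrank K ↥(LinearMap.ker (A + t₀ • B))
        + finrank K ↥(LinearMap.ker A ⊓ LinearMap.ker B) :=
  sum_finrank_ker_add_smul_le_aux S hS t₀ (finrank K V) A B rfl

end Main

section Corollaries

variable {K : Type*} [Field K] {V W : Type*} [AddCommGroup V] [Module K V] [FiniteDimensional K V]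
  [AddCommGroup W] [Module K W] [FiniteDimensional K W]

/-- **Jump bound** (the one-value case): for `μ ≠ 0`,
`dim ker(A + μB) ≤ dim(im A ∩ im B) + dim(ker A ∩ ker B)`, i.e. `e(μ) ≤ dim J`.
[cite: Gantmacher1984, Vol. 2 Ch. XII §4 eq. (30), §5 Thm. 5 (Kronecker); consequence] -/
theorem finrank_ker_add_smul_le_of_ne_zero (A B : V →ₗ[K] W) {μ : K} (hμ : μ ≠ 0) :
    finrank K ↥(LinearMap.ker (A + μ • B)) ≤
      finrank K ↥(LinearMap.range A ⊓ LinearMap.range B) + finrank K ↥(LinearMap.ker A ⊓ LinearMap.ker B) := by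
  have h := sum_finrank_ker_add_smul_le A B {μ} (by simpa using hμ) 0
  rw [Finset.sum_singleton, Finset.card_singleton, Nat.sub_self, zero_mul, add_zero] at h
  exact h

/-- **Jump budget, printed form** (`e(μ) = dim ker(A + μB) − dim(ker A ∩ ker B)`, `J = im A ∩ im B`):
for a NONEMPTY finite set `S` of nonzero scalars and any `t₀`,
`Σ_{μ ∈ S} (e(μ) − e(t₀)) ≤ dim J − e(t₀)`, written over `ℤ` as
`Σ_{μ ∈ S} (dim ker(A + μB) − dim ker(A + t₀B)) ≤ dim J + dim(ker A ∩ ker B) − dim ker(A + t₀B)`.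
[cite: Gantmacher1984, Vol. 2 Ch. XII §4 eq. (30), §5 Thm. 5 (Kronecker); consequence] -/
theorem sum_sub_finrank_ker_le_of_nonempty (A B : V →ₗ[K] W) (S : Finset K) (hS : ∀ μ ∈ S, μ ≠ 0)
    (hne : S.Nonempty) (t₀ : K) :
    ∑ μ ∈ S, ((finrank K ↥(LinearMap.ker (A + μ • B)) : ℤ) - finrank K ↥(LinearMap.ker (A + t₀ • B))) ≤
      (finrank K ↥(LinearMap.range A ⊓ LinearMap.range B) : ℤ)
        + finrank K ↥(LinearMap.ker A ⊓ LinearMap.ker B) - finrank K ↥(LinearMap.ker (A + t₀ • B)) := by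
  have h := sum_finrank_ker_add_smul_le A B S hS t₀
  have hc : 1 ≤ S.card := hne.card_pos
  obtain ⟨k, hk⟩ : ∃ k, S.card = k + 1 := ⟨S.card - 1, by omega⟩
  rw [hk, Nat.add_sub_cancel] at h
  rw [Finset.sum_sub_distrib, Finset.sum_const, hk, nsmul_eq_mul]
  have h' : ((∑ μ ∈ S, finrank K ↥(LinearMap.ker (A + μ • B)) : ℕ) : ℤ) ≤
      ((finrank K ↥(LinearMap.range A ⊓ LinearMap.range B)
        + k * finrank K ↥(LinearMap.ker (A + t₀ • B))
        + finrank K ↥(LinearMap.ker A ⊓ LinearMap.ker B) : ℕ) : ℤ) := by exact_mod_cast h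
  push_cast at h' ⊢
  nlinarith [h']

/-- **Jump budget, printed form, `t₀ ≠ 0`**: for `t₀ ≠ 0` the inequality of
`sum_sub_finrank_ker_le_of_nonempty` holds for EVERY finite set `S` of nonzero scalars (for `S = ∅` it is the
jump bound at `t₀`). [cite: Gantmacher1984, Vol. 2 Ch. XII §4 eq. (30), §5 Thm. 5 (Kronecker); consequence] -/
theorem sum_sub_finrank_ker_le (A B : V →ₗ[K] W) (S : Finset K) (hS : ∀ μ ∈ S, μ ≠ 0) {t₀ : K}
    (ht₀ : t₀ ≠ 0) :
    ∑ μ ∈ S, ((finrank K ↥(LinearMap.ker (A + μ • B)) : ℤ) - finrank K ↥(LinearMap.ker (A + t₀ • B))) ≤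
      (finrank K ↥(LinearMap.range A ⊓ LinearMap.range B) : ℤ)
        + finrank K ↥(LinearMap.ker A ⊓ LinearMap.ker B) - finrank K ↥(LinearMap.ker (A + t₀ • B)) := by
  rcases S.eq_empty_or_nonempty with rfl | hne
  · rw [Finset.sum_empty]
    have h := finrank_ker_add_smul_le_of_ne_zero A B ht₀
    have h' : ((finrank K ↥(LinearMap.ker (A + t₀ • B)) : ℕ) : ℤ) ≤
        ((finrank K ↥(LinearMap.range A ⊓ LinearMap.range B)
          + finrank K ↥(LinearMap.ker A ⊓ LinearMap.ker B) : ℕ) : ℤ) := by exact_mod_cast h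
    push_cast at h'
    linarith
  · exact sum_sub_finrank_ker_le_of_nonempty A B S hS hne t₀

/-- **Counting exceptional values**: if `t₀ ≠ 0` and every `μ ∈ S` is nonzero with
`dim ker(A + μB) > dim ker(A + t₀B)`, then `#S + dim ker(A + t₀B) ≤ dim(im A ∩ im B) + dim(ker A ∩ ker B)`,
i.e. `#S ≤ dim J − e(t₀)` (each exceptional value spends at least one unit of the budget).  Compare
`PencilRankDropCount.ncard_pencil_rank_lt_add_le` (after [cite: Kloosterman2025, Lemma 2.6]), which bounds the
same count by `rank A + rank B − rank(A + t₀B) ≥ dim J − e(t₀)`.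
[cite: Gantmacher1984, Vol. 2 Ch. XII §4 eq. (30), §5 Thm. 5 (Kronecker); consequence] -/
theorem card_add_finrank_ker_le (A B : V →ₗ[K] W) {t₀ : K} (ht₀ : t₀ ≠ 0) (S : Finset K)
    (hS : ∀ μ ∈ S, μ ≠ 0 ∧
      finrank K ↥(LinearMap.ker (A + t₀ • B)) < finrank K ↥(LinearMap.ker (A + μ • B))) :
    S.card + finrank K ↥(LinearMap.ker (A + t₀ • B)) ≤
      finrank K ↥(LinearMap.range A ⊓ LinearMap.range B) + finrank K ↥(LinearMap.ker A ⊓ LinearMap.ker B) := by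
  have h := sum_finrank_ker_add_smul_le A B S (fun μ hμ => (hS μ hμ).1) t₀
  have hlow : S.card * (finrank K ↥(LinearMap.ker (A + t₀ • B)) + 1) ≤
      ∑ μ ∈ S, finrank K ↥(LinearMap.ker (A + μ • B)) := by
    rw [← smul_eq_mul, ← Finset.sum_const]
    exact Finset.sum_le_sum fun μ hμ => (hS μ hμ).2
  rcases Nat.eq_zero_or_pos S.card with hc | hc
  · rw [hc, zero_add]
    exact finrank_ker_add_smul_le_of_ne_zero A B ht₀
  · obtain ⟨k, hk⟩ : ∃ k, S.card = k + 1 := ⟨S.card - 1, by omega⟩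
    rw [hk, Nat.add_sub_cancel] at h
    rw [hk] at hlow ⊢
    nlinarith [h, hlow]

/-- The set of nonzero exceptional values `{μ ≠ 0 : dim ker(A + μB) > dim ker(A + t₀B)}` (`t₀ ≠ 0`) is finite.
[cite: Gantmacher1984, Vol. 2 Ch. XII §4 eq. (30), §5 Thm. 5 (Kronecker); consequence] -/
theorem setOf_finrank_ker_lt_finite (A B : V →ₗ[K] W) {t₀ : K} (ht₀ : t₀ ≠ 0) :
    {μ : K | μ ≠ 0 ∧
      finrank K ↥(LinearMap.ker (A + t₀ • B)) < finrank K ↥(LinearMap.ker (A + μ • B))}.Finite := by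
  by_contra hinf
  obtain ⟨T, hT, hcard⟩ := Set.Infinite.exists_subset_card_eq hinf
    (finrank K ↥(LinearMap.range A ⊓ LinearMap.range B) + finrank K ↥(LinearMap.ker A ⊓ LinearMap.ker B) + 1)
  have h := card_add_finrank_ker_le A B ht₀ T fun μ hμ => hT (Finset.mem_coe.mpr hμ)
  omega

/-- **Counting exceptional values, set form**: for `t₀ ≠ 0`,
`#{μ ≠ 0 : dim ker(A + μB) > dim ker(A + t₀B)} + dim ker(A + t₀B) ≤ dim(im A ∩ im B) + dim(ker A ∩ ker B)`.
[cite: Gantmacher1984, Vol. 2 Ch. XII §4 eq. (30), §5 Thm. 5 (Kronecker); consequence] -/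
theorem ncard_setOf_finrank_ker_lt_add_le (A B : V →ₗ[K] W) {t₀ : K} (ht₀ : t₀ ≠ 0) :
    {μ : K | μ ≠ 0 ∧
      finrank K ↥(LinearMap.ker (A + t₀ • B)) < finrank K ↥(LinearMap.ker (A + μ • B))}.ncard
        + finrank K ↥(LinearMap.ker (A + t₀ • B)) ≤
      finrank K ↥(LinearMap.range A ⊓ LinearMap.range B) + finrank K ↥(LinearMap.ker A ⊓ LinearMap.ker B) := by
  have hfin := setOf_finrank_ker_lt_finite A B ht₀
  rw [Set.ncard_eq_toFinset_card _ hfin]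
  exact card_add_finrank_ker_le A B ht₀ hfin.toFinset fun μ hμ => (Set.Finite.mem_toFinset hfin).mp hμ

/-- **Exhaustion**: if finitely many nonzero values `T` already exhaust the jump budget relative to `t₀`,
`dim J + #T·dim ker(A + t₀B) + dim(ker A ∩ ker B) ≤ Σ_{τ ∈ T} dim ker(A + τB) + dim ker(A + t₀B)`
(that is, `Σ_{τ ∈ T} (e(τ) − e(t₀)) ≥ dim J − e(t₀)`, hence `=`), then NO other nonzero value jumps above
`t₀`: `dim ker(A + μB) ≤ dim ker(A + t₀B)` for every `μ ∉ T ∪ {0}`.  (So a sampled list of special values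
that exhausts the budget is complete.)
[cite: Gantmacher1984, Vol. 2 Ch. XII §4 eq. (30), §5 Thm. 5 (Kronecker); consequence] -/
theorem finrank_ker_add_smul_le_of_exhausted (A B : V →ₗ[K] W) (T : Finset K) (hT : ∀ τ ∈ T, τ ≠ 0)
    (t₀ : K)
    (hexh : finrank K ↥(LinearMap.range A ⊓ LinearMap.range B)
        + T.card * finrank K ↥(LinearMap.ker (A + t₀ • B)) + finrank K ↥(LinearMap.ker A ⊓ LinearMap.ker B) ≤
      ∑ τ ∈ T, finrank K ↥(LinearMap.ker (A + τ • B)) + finrank K ↥(LinearMap.ker (A + t₀ • B)))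
    {μ : K} (hμ : μ ≠ 0) (hμT : μ ∉ T) :
    finrank K ↥(LinearMap.ker (A + μ • B)) ≤ finrank K ↥(LinearMap.ker (A + t₀ • B)) := by
  classical
  have h := sum_finrank_ker_add_smul_le A B (insert μ T)
    (fun ν hν => by
      rcases Finset.mem_insert.mp hν with rfl | hν
      · exact hμ
      · exact hT ν hν) t₀
  rw [Finset.sum_insert hμT, Finset.card_insert_of_notMem hμT, Nat.add_sub_cancel] at h
  omega

end Corollaries

end Literature.LinearAlgebra.Matrix
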